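import Literature.AlgebraicGeometry.ModuliOfAbelianVarieties.SiegelFamilyHumbertModularSplit
import Literature.AlgebraicGeometry.ModuliOfAbelianVarieties.SiegelFamilyHumbertModularLattice
import HarnessLib

/-!
# Runge's modular embedding is equivariant: `π[R](M·τ) = (ᵗR 0; 0 R⁻¹) σ(M) (ᵗR 0; 0 R⁻¹)⁻¹ · π[R](τ)` for
# `M ∈ SL₂(ℝ) × SL₂(ℝ)`, and the translations by `O` and the units of `O` land in `Sp₄(ℤ)`

Layer `Literature/AlgebraicGeometry/ModuliOfAbelianVarieties`, namespace
`Literature.AlgebraicGeometry.ModuliOfAbelianVarieties.SiegelModuli`; lane `lit-hodgefound` (Track 2 foundations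
library, Layer A4), seat `lit-hodgefound-skel-4`, row **A4-70**, FILE 3 (rider; definitions with bodies + theorems, no
named fact). Uses row A4-64 (`SiegelFamilyHumbertModularEmbedding`: `rungeMatrix = R = (σ_s(ω_j))`, `modularEmbedding
= π[R]`, `transpose_rungeMatrix_mul_self = ᵗRR`; F6 `SiegelFamilyHumbertModularSplit`: `diagPoint τ = diag(τ₁, τ₂)`;
`SiegelFamilyHumbertModularEquivalence`: `blockDiagSp`, `coe_blockDiagSp`, `toGD_one_eq_transpose`), row A4-66/67
(`SiegelFamilyHumbertRealMultiplication` / `SiegelFamilyHumbertModularLattice`: the real embeddings `realEmb h s = σ_s :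
O → ℝ` of `O = ℤ[ω]`, Runge's `A(x) = regRep x`, `regRep_mul_transpose_rungeMatrix : A(x)ᵗR = ᵗR diag(σ(x))`,
`rungeMatrix_mul_transpose_regRep`, the dual matrix `dualRungeMatrix = S = ᵗR⁻¹`), the tree's action of `Sp₄(ℝ)` on
`𝔥₂` (p25 `SiegelUpperHalfSpaceAction`: `coe_smul`, `moeb_def`, `num_fromBlocks`, `denom_fromBlocks`) and Mathlib's
action of `SL(2, ℝ)` on `ℍ` (`UpperHalfPlane.coe_specialLinearGroup_apply`), all BY NAME.

## Source, verbatim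

B. Runge, *Endomorphism rings of abelian surfaces and projective models of their moduli spaces*, Tohoku Math. J. 51
(1999), §4 pp. 290–291 (held `paper:doi-10-2748-tmj-1178224764`, p0008–p0009): "Let `σ₁, σ₂` be the projections
`F ⊗_ℚ ℝ = ℝ ⊕ ℝ → ℝ`. Let `σ : F ∋ x ↦ diag(σ₁(x), σ₂(x))`, which induces a map
`σ : Sl(2, F) ∋ (a b; c d) ↦ (σ(a) σ(b); σ(c) σ(d))`. We fix a `ℤ`-basis `1 = ω₁, ω = ω₂` for `O` and denote by
`R = (σ_i(ω_j))` … Let `x ∈ F` be arbitrary. Then `xω_i = Σ_j A_{ij} ω_j` for some matrix `A(x) = (A_{ij}) ∈ M_n(ℚ)`.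
It is easy to check that `A(x) = ᵗR σ(x) ᵗR⁻¹` and `x ∈ O ⟺ A(x) ∈ M₂(ℤ)`. We fix the embedding
`ℍ × ℍ ∋ (τ₁, τ₂) ↦ π[R] = ᵗR (τ₁ 0; 0 τ₂) R ∈ ℍ₂`. Because of [the displayed identity, p. 291: `π[R]` intertwines
`σ(M)` conjugated by `(ᵗR 0; 0 R⁻¹)`] … where the inclusion is given by `(ᵗR 0; 0 R⁻¹) (σ(·) 0; 0 σ(·)) (ᵗR 0; 0 R⁻¹)⁻¹`
… By taking the quotient `Γ(F)\H(F)`, we get the standard model for Humbert surfaces. The Humbert modular group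
`Γ(F) = Γ(Δ)` is described in the following lemma. Lemma 4. For any order `O` in a real quadratic algebra `F` there
exists a Rosati equivariant embedding `ψ_O : M₂(F) → M₄(ℚ)` … such that `ψ_O⁻¹(im(ψ_O) ∩ Γ₂) = Sl(2, O)` … The
Humbert modular group `Γ(F)` is generated by `σ₀` and `ψ_O(Sl(2, O))`."
C. T. McMullen, *Billiards and Teichmüller curves on Hilbert modular surfaces*, J. AMS 16 (2003), §6 (the modular
embedding is equivariant for `SL₂` of the order acting through its two real embeddings); N. Elkies, A. Kumar, *K3
surfaces and equations for Hilbert modular surfaces*, Algebra & Number Theory 8 (2014), §3 (`SL(O_D ⊕ O_D^*)` and the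
map to `𝒜₂`).

## What is proved (definitions with bodies + theorems; NO named fact, NO sorry, net debt 0)

* §1 **`slPairSp g`** — Runge's `σ(M) = (σ(a) σ(b); σ(c) σ(d)) ∈ Sp₄(ℝ)` for a pair `g = (σ₁(M), σ₂(M))` of real
  `2 × 2` matrices of determinant `1` (the embedding `SL₂(ℝ) × SL₂(ℝ) ↪ Sp₄(ℝ)` by diagonal blocks), as a group
  homomorphism `slPairSpHom`; **`slPairSp_smul_diagPoint`**: it acts on the diagonal `diag(τ₁, τ₂)` by the two Möbius
  transformations.
* §2 **`rungeConj k l hΔ = (ᵗR 0; 0 R⁻¹) ∈ Sp₄(ℝ)`** (`R⁻¹ = ᵗS`), **`rungeConj_smul_diagPoint`**: `(ᵗR 0; 0 R⁻¹) ·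
  diag(τ₁, τ₂) = ᵗR diag(τ) R = π[R](τ)` — the modular embedding is the `rungeConj`-translate of the diagonal.
* §3 **`modularEmbeddingLift k l hΔ g = (ᵗR 0; 0 R⁻¹) σ(g) (ᵗR 0; 0 R⁻¹)⁻¹`** (a group homomorphism
  `modularEmbeddingLiftHom : (SL₂(ℝ))² →* Sp₄(ℝ)`), the EQUIVARIANCE **`modularEmbedding_smul`**:
  `π[R](g·τ) = modularEmbeddingLift g · π[R](τ)`, and its blocks **`coe_modularEmbeddingLift`**:
  `(ᵗR diag(a) S, ᵗR diag(b) R; ᵗS diag(c) S, ᵗS diag(d) R)`.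
* §4 Integral elements ("`x ∈ O ⟹ A(x) ∈ M₂(ℤ)`"): for a translation `τ_s ↦ τ_s + σ_s(x)`, `x ∈ O`, the lift is the
  integral symplectic matrix `(1 B(x); 0 1)`, `B(x) = ᵗR diag(σ(x)) R = (ᵗRR)·ᵗA(x) ∈ M₂(ℤ)` symmetric
  (**`modularEmbeddingLift_transl`**, `traceRegRep`, `isSymm_traceRegRep`); for a unit, `τ_s ↦ σ_s(ε)² τ_s` written as
  `diag(σ_s(ε), σ_s(ε'))` with `εε' = 1`, the lift is `(A(ε) 0; 0 ᵗA(ε')) = blockDiagSp (ᵗA(ε)) (ᵗA(ε'))`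
  (**`modularEmbeddingLift_unitPair`**); in both cases the lift is `toGD 1 M` for an explicit `M ∈ Sp₄(ℤ)`
  (`ᵗM E₁ M = E₁`), so `π[R](g·τ)` and `π[R](τ)` have the same image in `𝒜₂ = Sp₄(ℤ)\𝔥₂`
  (**`modularEmbedding_transl`**, **`modularEmbedding_unitPair_smul`**) — with row A4-70 FILE 2's
  `siegelThreefold.mk_toGD_smul` this reads `[π[R](γ·τ)] = [π[R](τ)]` in `𝒜₂` for these `γ`; and the lifted
  `SL₂(ℝ)²` acts on Runge's model `H_{(k,l,−1,0,0)} = π[R](ℍ × ℍ)` (**`image_modularEmbeddingLift_smul_humbertLocus`**).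

Scope: Runge's Lemma 4 (the exact preimage `ψ_O⁻¹(Γ₂) = Sl(2, O)` after his twist `ψ_O`, and the generation of
`Γ(F)` by `σ₀` and `ψ_O(Sl(2, O))`) is not formalised; only the equivariance and the integrality of translations and
units (the parabolic and diagonal parts of the Hilbert modular group of `O ⊕ O^∨`) are.
-/

namespace Literature.AlgebraicGeometry.ModuliOfAbelianVarieties.SiegelModuli

open Matrix Complex UpperHalfPlane
open Literature.NumberTheory.Automorphic Literature.NumberTheory.ModularForms.SiegelUpperHalfSpace

/-! ## §1 Runge's `σ : SL₂(ℝ) × SL₂(ℝ) → Sp₄(ℝ)` by diagonal blocks -/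

section Pair

/-- The block matrix `(diag(a_s) diag(b_s); diag(c_s) diag(d_s))` of a pair `g = (g₀, g₁)` of real `2 × 2` matrices
(Runge's `σ(M)` for `g_s = σ_s(M)`). [cite: Runge1999EndomorphismRingsAbelianSurfaces, §4 p. 290] -/
def slPairMatrix (g : Fin 2 → Matrix (Fin 2) (Fin 2) ℝ) : Matrix (Fin 2 ⊕ Fin 2) (Fin 2 ⊕ Fin 2) ℝ :=
  Matrix.fromBlocks (diagonal fun s ↦ g s 0 0) (diagonal fun s ↦ g s 0 1) (diagonal fun s ↦ g s 1 0)
    (diagonal fun s ↦ g s 1 1)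

/-- `σ` is multiplicative (blockwise products of diagonal matrices). [cite: Runge1999EndomorphismRingsAbelianSurfaces, §4 p. 290] -/
theorem slPairMatrix_mul (g h : Fin 2 → Matrix (Fin 2) (Fin 2) ℝ) :
    slPairMatrix (g * h) = slPairMatrix g * slPairMatrix h := by
  simp only [slPairMatrix, Matrix.fromBlocks_multiply, diagonal_mul_diagonal, diagonal_add]
  congr 1 <;> (ext1 s; simp [Matrix.mul_apply, Fin.sum_univ_two])

/-- `σ(1) = 1`. [cite: Runge1999EndomorphismRingsAbelianSurfaces, §4 p. 290] -/
theorem slPairMatrix_one : slPairMatrix (fun _ : Fin 2 ↦ (1 : Matrix (Fin 2) (Fin 2) ℝ)) = 1 := by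
  simp only [slPairMatrix, ← Matrix.fromBlocks_one]
  congr 1 <;> (ext i j; fin_cases i <;> fin_cases j <;> simp [diagonal])

/-- **`σ(M) ∈ Sp₄(ℝ)` for `M` of determinant one in both real embeddings.** [cite: Runge1999EndomorphismRingsAbelianSurfaces, §4 p. 290] -/
theorem slPairMatrix_mem (g : Fin 2 → Matrix.SpecialLinearGroup (Fin 2) ℝ) :
    slPairMatrix (fun s ↦ (g s : Matrix (Fin 2) (Fin 2) ℝ)) ∈ Matrix.symplecticGroup (Fin 2) ℝ := by
  rw [slPairMatrix, SymplecticGroup.fromBlocks_mem_iff]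
  simp only [diagonal_transpose, diagonal_mul_diagonal]
  refine ⟨?_, ?_, ?_⟩
  · congr 1; ext s; ring
  · congr 1; ext s; ring
  · rw [diagonal_sub, ← diagonal_one]
    congr 1; ext s
    have h := (g s).det_coe
    rw [Matrix.det_fin_two] at h
    linear_combination h

/-- **Runge's `σ : Sl(2, F) → Sp(4, ℝ)`, `(a b; c d) ↦ (σ(a) σ(b); σ(c) σ(d))`, `σ(x) = diag(σ₁(x), σ₂(x))`**, written on
pairs `g = (σ₁(M), σ₂(M)) ∈ SL₂(ℝ) × SL₂(ℝ)`. [cite: Runge1999EndomorphismRingsAbelianSurfaces, §4 p. 290] -/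
def slPairSp (g : Fin 2 → Matrix.SpecialLinearGroup (Fin 2) ℝ) : Matrix.symplecticGroup (Fin 2) ℝ :=
  ⟨slPairMatrix fun s ↦ (g s : Matrix (Fin 2) (Fin 2) ℝ), slPairMatrix_mem g⟩

/-- The matrix of `slPairSp g`. [cite: Runge1999EndomorphismRingsAbelianSurfaces, §4 p. 290] -/
@[simp] theorem coe_slPairSp (g : Fin 2 → Matrix.SpecialLinearGroup (Fin 2) ℝ) :
    ((slPairSp g : Matrix.symplecticGroup (Fin 2) ℝ) : Matrix (Fin 2 ⊕ Fin 2) (Fin 2 ⊕ Fin 2) ℝ) =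
      slPairMatrix fun s ↦ (g s : Matrix (Fin 2) (Fin 2) ℝ) := rfl

/-- **`σ` as a group homomorphism `SL₂(ℝ) × SL₂(ℝ) →* Sp₄(ℝ)`.** [cite: Runge1999EndomorphismRingsAbelianSurfaces, §4 p. 290] -/
def slPairSpHom : (Fin 2 → Matrix.SpecialLinearGroup (Fin 2) ℝ) →* Matrix.symplecticGroup (Fin 2) ℝ where
  toFun := slPairSp
  map_one' := Subtype.ext (by simpa using slPairMatrix_one)
  map_mul' g h := Subtype.ext (by
    show slPairMatrix (fun s ↦ ((g * h) s : Matrix (Fin 2) (Fin 2) ℝ)) =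
      slPairMatrix (fun s ↦ (g s : Matrix (Fin 2) (Fin 2) ℝ)) * slPairMatrix (fun s ↦ (h s : Matrix (Fin 2) (Fin 2) ℝ))
    rw [← slPairMatrix_mul]; rfl)

/-- `slPairSpHom g = slPairSp g`. [cite: Runge1999EndomorphismRingsAbelianSurfaces, §4 p. 290] -/
@[simp] theorem slPairSpHom_apply (g : Fin 2 → Matrix.SpecialLinearGroup (Fin 2) ℝ) : slPairSpHom g = slPairSp g := rfl

/-- `c_s τ_s + d_s ≠ 0` for `τ_s ∈ ℍ` and `(c_s, d_s)` the bottom row of a matrix of determinant `1`. [folklore] -/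
private theorem denom_ne_zero' (g : Matrix.SpecialLinearGroup (Fin 2) ℝ) (z : ℍ) :
    ((g 1 0 : ℝ) : ℂ) * (z : ℂ) + ((g 1 1 : ℝ) : ℂ) ≠ 0 := by
  have h : (![g 1 0, g 1 1] : Fin 2 → ℝ) ≠ 0 := by
    intro h0
    have h1 : (g 1 0 : ℝ) = 0 := by simpa using congrFun h0 0
    have h2 : (g 1 1 : ℝ) = 0 := by simpa using congrFun h0 1
    have hd := g.det_coe
    rw [Matrix.det_fin_two, h1, h2, mul_zero, mul_zero, sub_zero] at hd
    exact zero_ne_one hd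
  simpa using linear_ne_zero z h

/-- **`σ(g)` acts on the diagonal `diag(τ₁, τ₂) ∈ 𝔥₂` through the two Möbius transformations:
`σ(g) · diag(τ₁, τ₂) = diag(g₁·τ₁, g₂·τ₂)`.** [cite: Runge1999EndomorphismRingsAbelianSurfaces, §4 pp. 290–291] -/
theorem slPairSp_smul_diagPoint (g : Fin 2 → Matrix.SpecialLinearGroup (Fin 2) ℝ) (τ : Fin 2 → ℍ) :
    slPairSp g • diagPoint τ = diagPoint fun s ↦ g s • τ s := by
  apply Subtype.ext
  have hden : diagonal (fun s ↦ ((g s 1 0 : ℝ) : ℂ) * (τ s : ℂ) + ((g s 1 1 : ℝ) : ℂ)) *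
      diagonal (fun s ↦ (((g s 1 0 : ℝ) : ℂ) * (τ s : ℂ) + ((g s 1 1 : ℝ) : ℂ))⁻¹) = 1 := by
    rw [diagonal_mul_diagonal, ← diagonal_one]
    congr 1; ext s
    exact mul_inv_cancel₀ (denom_ne_zero' (g s) (τ s))
  rw [Literature.NumberTheory.ModularForms.SiegelUpperHalfSpace.coe_smul, coe_slPairSp, slPairMatrix,
    Matrix.fromBlocks_map, coe_diagPoint, coe_diagPoint, moeb_def,
    num_fromBlocks, denom_fromBlocks, diagonal_map (Complex.ofReal_zero), diagonal_map (Complex.ofReal_zero),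
    diagonal_map (Complex.ofReal_zero), diagonal_map (Complex.ofReal_zero), diagonal_mul_diagonal,
    diagonal_mul_diagonal, diagonal_add, diagonal_add]
  rw [Matrix.inv_eq_right_inv hden, diagonal_mul_diagonal]
  congr 1; ext s
  rw [coe_specialLinearGroup_apply, div_eq_mul_inv]
  simp

end Pair

/-! ## §2 `(ᵗR 0; 0 R⁻¹) ∈ Sp₄(ℝ)` carries the diagonal onto Runge's model -/

section Conj

variable {k l : ℤ}

/-- `R ᵗS = 1`. [folklore] -/
private theorem rungeMatrix_mul_transpose_dualRungeMatrix (hΔ : 0 < quadDisc k l) :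
    rungeMatrix k l * (dualRungeMatrix k l)ᵀ = 1 := by
  have h := congrArg Matrix.transpose (dualRungeMatrix_mul_transpose_rungeMatrix k l hΔ)
  rwa [transpose_mul, transpose_transpose, transpose_one] at h

/-- `ᵗS R = 1`. [folklore] -/
private theorem transpose_dualRungeMatrix_mul_rungeMatrix (hΔ : 0 < quadDisc k l) :
    (dualRungeMatrix k l)ᵀ * rungeMatrix k l = 1 := by
  have h := congrArg Matrix.transpose (transpose_rungeMatrix_mul_dualRungeMatrix k l hΔ)
  rwa [transpose_mul, transpose_transpose, transpose_one] at h

/-- `(MN)` cast to `ℂ` is the product of the casts. [folklore] -/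
private theorem map_ofReal_mul' (M N : Matrix (Fin 2) (Fin 2) ℝ) :
    (M * N).map ((↑) : ℝ → ℂ) = M.map ((↑) : ℝ → ℂ) * N.map ((↑) : ℝ → ℂ) :=
  Matrix.map_mul (f := Complex.ofRealHom)

/-- **`(ᵗR 0; 0 R⁻¹) ∈ Sp₄(ℝ)`** (`R⁻¹ = ᵗS`, `S = dualRungeMatrix = ᵗR⁻¹`). [cite: Runge1999EndomorphismRingsAbelianSurfaces, §4 p. 291] -/
noncomputable def rungeConj (k l : ℤ) (hΔ : 0 < quadDisc k l) : Matrix.symplecticGroup (Fin 2) ℝ :=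
  ⟨Matrix.fromBlocks (rungeMatrix k l)ᵀ 0 0 (dualRungeMatrix k l)ᵀ, by
    rw [SymplecticGroup.fromBlocks_mem_iff]
    refine ⟨by simp, by simp, ?_⟩
    rw [transpose_transpose, Matrix.transpose_zero, Matrix.zero_mul, sub_zero]
    exact rungeMatrix_mul_transpose_dualRungeMatrix hΔ⟩

/-- The matrix of `rungeConj`. [cite: Runge1999EndomorphismRingsAbelianSurfaces, §4 p. 291] -/
@[simp] theorem coe_rungeConj (hΔ : 0 < quadDisc k l) :
    ((rungeConj k l hΔ : Matrix.symplecticGroup (Fin 2) ℝ) : Matrix (Fin 2 ⊕ Fin 2) (Fin 2 ⊕ Fin 2) ℝ) =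
      Matrix.fromBlocks (rungeMatrix k l)ᵀ 0 0 (dualRungeMatrix k l)ᵀ := rfl

/-- The inverse `(ᵗR 0; 0 R⁻¹)⁻¹ = (S 0; 0 R)`. [cite: Runge1999EndomorphismRingsAbelianSurfaces, §4 p. 291] -/
theorem coe_rungeConj_inv (hΔ : 0 < quadDisc k l) :
    (((rungeConj k l hΔ)⁻¹ : Matrix.symplecticGroup (Fin 2) ℝ) : Matrix (Fin 2 ⊕ Fin 2) (Fin 2 ⊕ Fin 2) ℝ) =
      Matrix.fromBlocks (dualRungeMatrix k l) 0 0 (rungeMatrix k l) := by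
  have hmem : Matrix.fromBlocks (dualRungeMatrix k l) 0 0 (rungeMatrix k l) ∈ Matrix.symplecticGroup (Fin 2) ℝ := by
    rw [SymplecticGroup.fromBlocks_mem_iff]
    refine ⟨by simp, by simp, ?_⟩
    rw [Matrix.transpose_zero, Matrix.zero_mul, sub_zero]
    exact transpose_dualRungeMatrix_mul_rungeMatrix hΔ
  have h : rungeConj k l hΔ * ⟨_, hmem⟩ = 1 := by
    apply Subtype.ext
    show Matrix.fromBlocks (rungeMatrix k l)ᵀ 0 0 (dualRungeMatrix k l)ᵀ *
      Matrix.fromBlocks (dualRungeMatrix k l) 0 0 (rungeMatrix k l) = 1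
    rw [Matrix.fromBlocks_multiply, transpose_rungeMatrix_mul_dualRungeMatrix k l hΔ,
      transpose_dualRungeMatrix_mul_rungeMatrix hΔ, ← Matrix.fromBlocks_one]
    simp
  rw [inv_eq_of_mul_eq_one_right h]

/-- **`(ᵗR 0; 0 R⁻¹) · diag(τ₁, τ₂) = ᵗR diag(τ₁, τ₂) R = π[R](τ)`**: Runge's model is the translate of the diagonal
(`(ᵗR·D + 0)(0·D + R⁻¹)⁻¹ = ᵗR D R`). [cite: Runge1999EndomorphismRingsAbelianSurfaces, §4 pp. 290–291] -/
theorem rungeConj_smul_diagPoint (hΔ : 0 < quadDisc k l) (τ : Fin 2 → ℍ) :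
    rungeConj k l hΔ • diagPoint τ = modularEmbedding k l hΔ τ := by
  apply Subtype.ext
  have hSR : ((dualRungeMatrix k l)ᵀ).map ((↑) : ℝ → ℂ) * (rungeMatrix k l).map ((↑) : ℝ → ℂ) = 1 := by
    rw [← map_ofReal_mul', transpose_dualRungeMatrix_mul_rungeMatrix hΔ,
      Matrix.map_one _ Complex.ofReal_zero Complex.ofReal_one]
  rw [Literature.NumberTheory.ModularForms.SiegelUpperHalfSpace.coe_smul, coe_rungeConj, Matrix.fromBlocks_map,
    coe_diagPoint, coe_modularEmbedding, moeb_def, num_fromBlocks, denom_fromBlocks,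
    Matrix.map_zero _ Complex.ofReal_zero, Matrix.zero_mul, zero_add, add_zero, Matrix.inv_eq_right_inv hSR,
    modularEmbeddingMatrix, transpose_map]

end Conj

/-! ## §3 The lift `(ᵗR 0; 0 R⁻¹) σ(g) (ᵗR 0; 0 R⁻¹)⁻¹` and the equivariance of `π[R]` -/

section Lift

variable {k l : ℤ}

/-- **The lift of `g = (σ₁(M), σ₂(M))` to `Sp₄(ℝ)` along Runge's embedding: `(ᵗR 0; 0 R⁻¹) σ(g) (ᵗR 0; 0 R⁻¹)⁻¹`.**
[cite: Runge1999EndomorphismRingsAbelianSurfaces, §4 p. 291] -/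
noncomputable def modularEmbeddingLift (k l : ℤ) (hΔ : 0 < quadDisc k l) (g : Fin 2 → Matrix.SpecialLinearGroup (Fin 2) ℝ) :
    Matrix.symplecticGroup (Fin 2) ℝ :=
  rungeConj k l hΔ * slPairSp g * (rungeConj k l hΔ)⁻¹

/-- The lift as a group homomorphism `SL₂(ℝ) × SL₂(ℝ) →* Sp₄(ℝ)` (conjugation of `σ`).
[cite: Runge1999EndomorphismRingsAbelianSurfaces, §4 p. 291] -/
noncomputable def modularEmbeddingLiftHom (k l : ℤ) (hΔ : 0 < quadDisc k l) :
    (Fin 2 → Matrix.SpecialLinearGroup (Fin 2) ℝ) →* Matrix.symplecticGroup (Fin 2) ℝ :=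
  (MulAut.conj (rungeConj k l hΔ)).toMonoidHom.comp slPairSpHom

/-- `modularEmbeddingLiftHom g = modularEmbeddingLift g`. [cite: Runge1999EndomorphismRingsAbelianSurfaces, §4 p. 291] -/
@[simp] theorem modularEmbeddingLiftHom_apply (hΔ : 0 < quadDisc k l) (g : Fin 2 → Matrix.SpecialLinearGroup (Fin 2) ℝ) :
    modularEmbeddingLiftHom k l hΔ g = modularEmbeddingLift k l hΔ g := rfl

/-- The lift is multiplicative. [cite: Runge1999EndomorphismRingsAbelianSurfaces, §4 p. 291] -/
theorem modularEmbeddingLift_mul (hΔ : 0 < quadDisc k l) (g h : Fin 2 → Matrix.SpecialLinearGroup (Fin 2) ℝ) :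
    modularEmbeddingLift k l hΔ (g * h) = modularEmbeddingLift k l hΔ g * modularEmbeddingLift k l hΔ h :=
  map_mul (modularEmbeddingLiftHom k l hΔ) g h

/-- The lift of the identity. [cite: Runge1999EndomorphismRingsAbelianSurfaces, §4 p. 291] -/
@[simp] theorem modularEmbeddingLift_one (hΔ : 0 < quadDisc k l) : modularEmbeddingLift k l hΔ 1 = 1 :=
  map_one (modularEmbeddingLiftHom k l hΔ)

/-- The lift of an inverse. [cite: Runge1999EndomorphismRingsAbelianSurfaces, §4 p. 291] -/
theorem modularEmbeddingLift_inv (hΔ : 0 < quadDisc k l) (g : Fin 2 → Matrix.SpecialLinearGroup (Fin 2) ℝ) :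
    modularEmbeddingLift k l hΔ g⁻¹ = (modularEmbeddingLift k l hΔ g)⁻¹ :=
  map_inv (modularEmbeddingLiftHom k l hΔ) g

/-- **RUNGE'S MODULAR EMBEDDING IS EQUIVARIANT: `π[R](g·τ) = ((ᵗR 0; 0 R⁻¹) σ(g) (ᵗR 0; 0 R⁻¹)⁻¹) · π[R](τ)`** for every
pair `g ∈ SL₂(ℝ) × SL₂(ℝ)` acting on `ℍ × ℍ` factorwise (`τ_s ↦ (a_sτ_s + b_s)/(c_sτ_s + d_s)`) and `Sp₄(ℝ)` acting
on `𝔥₂` by `Z ↦ (αZ + β)(γZ + δ)⁻¹`. [cite: Runge1999EndomorphismRingsAbelianSurfaces, §4 pp. 290–291] -/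
theorem modularEmbedding_smul (hΔ : 0 < quadDisc k l) (g : Fin 2 → Matrix.SpecialLinearGroup (Fin 2) ℝ)
    (τ : Fin 2 → ℍ) :
    modularEmbedding k l hΔ (fun s ↦ g s • τ s) = modularEmbeddingLift k l hΔ g • modularEmbedding k l hΔ τ := by
  rw [modularEmbeddingLift, mul_smul, mul_smul, ← rungeConj_smul_diagPoint hΔ τ, inv_smul_smul,
    slPairSp_smul_diagPoint, rungeConj_smul_diagPoint]

/-- The same with the pointwise action of `SL₂(ℝ)²` on `ℍ²`. [cite: Runge1999EndomorphismRingsAbelianSurfaces, §4 pp. 290–291] -/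
theorem modularEmbedding_smul' (hΔ : 0 < quadDisc k l) (g : Fin 2 → Matrix.SpecialLinearGroup (Fin 2) ℝ)
    (τ : Fin 2 → ℍ) :
    modularEmbedding k l hΔ (g • τ) = modularEmbeddingLift k l hΔ g • modularEmbedding k l hΔ τ :=
  modularEmbedding_smul hΔ g τ

/-- **The lifted group preserves Runge's model `H = π[R](ℍ × ℍ) = H_{(k,l,−1,0,0)}`** ("it is obvious that `Γ(L)` is
acting on `H(L)`", here for all of `SL₂(ℝ)²`). [cite: Runge1999EndomorphismRingsAbelianSurfaces, §3 p. 287, §4 p. 291] -/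
theorem modularEmbeddingLift_smul_mem_humbertLocus (hΔ : 0 < quadDisc k l) (g : Fin 2 → Matrix.SpecialLinearGroup (Fin 2) ℝ)
    {Z : siegelUpperHalfSpace 2} (hZ : Z ∈ humbertLocus (fun i ↦ (humbertNormalForm k l i : ℂ))) :
    modularEmbeddingLift k l hΔ g • Z ∈ humbertLocus (fun i ↦ (humbertNormalForm k l i : ℂ)) := by
  rw [← range_modularEmbedding hΔ] at hZ ⊢
  obtain ⟨τ, rfl⟩ := hZ
  exact ⟨fun s ↦ g s • τ s, modularEmbedding_smul hΔ g τ⟩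

/-- … and acts on it: `g · H = H`. [cite: Runge1999EndomorphismRingsAbelianSurfaces, §3 p. 287, §4 p. 291] -/
theorem image_modularEmbeddingLift_smul_humbertLocus (hΔ : 0 < quadDisc k l)
    (g : Fin 2 → Matrix.SpecialLinearGroup (Fin 2) ℝ) :
    (fun Z ↦ modularEmbeddingLift k l hΔ g • Z) '' humbertLocus (fun i ↦ (humbertNormalForm k l i : ℂ)) =
      humbertLocus (fun i ↦ (humbertNormalForm k l i : ℂ)) := by
  refine Set.Subset.antisymm ?_ fun Z hZ ↦ ?_
  · rintro _ ⟨Z, hZ, rfl⟩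
    exact modularEmbeddingLift_smul_mem_humbertLocus hΔ g hZ
  · refine ⟨modularEmbeddingLift k l hΔ g⁻¹ • Z, modularEmbeddingLift_smul_mem_humbertLocus hΔ g⁻¹ hZ, ?_⟩
    simp only [modularEmbeddingLift_inv, smul_inv_smul]

/-- **The blocks of the lift: `(ᵗR diag(a) S, ᵗR diag(b) R; ᵗS diag(c) S, ᵗS diag(d) R)`** (`S = ᵗR⁻¹`; Runge's
`A(a) = ᵗR σ(a) ᵗR⁻¹` in the upper left corner). [cite: Runge1999EndomorphismRingsAbelianSurfaces, §4 pp. 290–291] -/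
theorem coe_modularEmbeddingLift (hΔ : 0 < quadDisc k l) (g : Fin 2 → Matrix.SpecialLinearGroup (Fin 2) ℝ) :
    ((modularEmbeddingLift k l hΔ g : Matrix.symplecticGroup (Fin 2) ℝ) : Matrix (Fin 2 ⊕ Fin 2) (Fin 2 ⊕ Fin 2) ℝ) =
      Matrix.fromBlocks
        ((rungeMatrix k l)ᵀ * diagonal (fun s ↦ (g s 0 0 : ℝ)) * dualRungeMatrix k l)
        ((rungeMatrix k l)ᵀ * diagonal (fun s ↦ (g s 0 1 : ℝ)) * rungeMatrix k l)
        ((dualRungeMatrix k l)ᵀ * diagonal (fun s ↦ (g s 1 0 : ℝ)) * dualRungeMatrix k l)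
        ((dualRungeMatrix k l)ᵀ * diagonal (fun s ↦ (g s 1 1 : ℝ)) * rungeMatrix k l) := by
  rw [modularEmbeddingLift, Submonoid.coe_mul, Submonoid.coe_mul, coe_rungeConj, coe_slPairSp, coe_rungeConj_inv,
    slPairMatrix, Matrix.fromBlocks_multiply, Matrix.fromBlocks_multiply]
  simp [Matrix.mul_assoc]

end Lift

/-! ## §4 Integral lifts: translations by `O` and units of `O` ("`x ∈ O ⟺ A(x) ∈ M₂(ℤ)`") -/

section Integral

variable {k l : ℤ}

/-- The pair of translations `τ_s ↦ τ_s + x_s`. [cite: Runge1999EndomorphismRingsAbelianSurfaces, §4 p. 291] -/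
def translPair (x : Fin 2 → ℝ) : Fin 2 → Matrix.SpecialLinearGroup (Fin 2) ℝ :=
  fun s ↦ ⟨!![1, x s; 0, 1], by rw [Matrix.det_fin_two_of]; ring⟩

/-- Entries of `translPair`. [cite: Runge1999EndomorphismRingsAbelianSurfaces, §4 p. 291] -/
@[simp] theorem coe_translPair (x : Fin 2 → ℝ) (s : Fin 2) :
    ((translPair x s : Matrix.SpecialLinearGroup (Fin 2) ℝ) : Matrix (Fin 2) (Fin 2) ℝ) = !![1, x s; 0, 1] := rfl

/-- `translPair x` acts by `τ_s ↦ τ_s + x_s`. [cite: Runge1999EndomorphismRingsAbelianSurfaces, §4 p. 291] -/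
theorem coe_translPair_smul (x : Fin 2 → ℝ) (τ : Fin 2 → ℍ) (s : Fin 2) :
    ((translPair x s • τ s : ℍ) : ℂ) = (τ s : ℂ) + x s := by
  rw [coe_specialLinearGroup_apply]
  simp

/-- **`B(x) = (ᵗRR)·ᵗA(x) = (Tr(x ω_i ω_j))_{ij} ∈ M₂(ℤ)`**, the Gram matrix of the trace form twisted by `x ∈ O`
(`ᵗRR = (2 l; l l² + 2k)`, `A(x) = regRep x`). [cite: Runge1999EndomorphismRingsAbelianSurfaces, §4 p. 290] -/
def traceRegRep (k l : ℤ) (x : QuadraticAlgebra ℤ k l) : Matrix (Fin 2) (Fin 2) ℤ :=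
  !![2, l; l, l ^ 2 + 2 * k] * (regRep k l x)ᵀ

/-- The entries of `B(x)` for `x = a + bω`: `B(x) = (Tr(x), Tr(xω); Tr(xω), Tr(xω²)) =
(2a + lb, la + (l² + 2k)b; la + (l² + 2k)b, (l² + 2k)a + (l³ + 3kl)b)`. [cite: Runge1999EndomorphismRingsAbelianSurfaces, §4 p. 290] -/
theorem traceRegRep_eq (x : QuadraticAlgebra ℤ k l) :
    traceRegRep k l x = !![2 * x.re + l * x.im, l * x.re + (l ^ 2 + 2 * k) * x.im;
      l * x.re + (l ^ 2 + 2 * k) * x.im, (l ^ 2 + 2 * k) * x.re + (l ^ 3 + 3 * k * l) * x.im] := by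
  ext i j
  fin_cases i <;> fin_cases j <;> simp [traceRegRep, regRep, Matrix.mul_apply, Fin.sum_univ_two] <;> ring

/-- `B(x)` is symmetric. [cite: Runge1999EndomorphismRingsAbelianSurfaces, §4 p. 290] -/
theorem isSymm_traceRegRep (x : QuadraticAlgebra ℤ k l) : (traceRegRep k l x).IsSymm := by
  rw [traceRegRep_eq]
  ext i j
  fin_cases i <;> fin_cases j <;> simp

/-- **`ᵗR diag(σ(x)) R = B(x)`** for `x ∈ O`. [cite: Runge1999EndomorphismRingsAbelianSurfaces, §4 p. 290] -/
theorem transpose_rungeMatrix_mul_diagonal_mul_rungeMatrix (h : 0 ≤ quadDisc k l) (x : QuadraticAlgebra ℤ k l) :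
    (rungeMatrix k l)ᵀ * diagonal (fun s ↦ realEmb h s x) * rungeMatrix k l =
      (traceRegRep k l x).map (Int.cast : ℤ → ℝ) := by
  have hm : (!![2, l; l, l ^ 2 + 2 * k] * (regRep k l x)ᵀ).map (Int.cast : ℤ → ℝ) =
      (!![2, l; l, l ^ 2 + 2 * k] : Matrix (Fin 2) (Fin 2) ℤ).map (Int.cast : ℤ → ℝ) *
        ((regRep k l x)ᵀ).map (Int.cast : ℤ → ℝ) :=
    Matrix.map_mul (f := Int.castRingHom ℝ)
  rw [Matrix.mul_assoc, ← rungeMatrix_mul_transpose_regRep h x, ← Matrix.mul_assoc, transpose_rungeMatrix_mul_self h,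
    traceRegRep, hm, transpose_map]
  congr 1
  ext i j; fin_cases i <;> fin_cases j <;> simp

/-- **The lift of the translation by `x ∈ O` is `(1 B(x); 0 1)`.** [cite: Runge1999EndomorphismRingsAbelianSurfaces, §4 pp. 290–291] -/
theorem coe_modularEmbeddingLift_translPair (hΔ : 0 < quadDisc k l) (x : QuadraticAlgebra ℤ k l) :
    ((modularEmbeddingLift k l hΔ (translPair fun s ↦ realEmb hΔ.le s x) : Matrix.symplecticGroup (Fin 2) ℝ) :
        Matrix (Fin 2 ⊕ Fin 2) (Fin 2 ⊕ Fin 2) ℝ) =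
      Matrix.fromBlocks 1 ((traceRegRep k l x).map (Int.cast : ℤ → ℝ)) 0 1 := by
  rw [coe_modularEmbeddingLift, ← transpose_rungeMatrix_mul_diagonal_mul_rungeMatrix hΔ.le x]
  simp only [coe_translPair, Matrix.of_apply, Matrix.cons_val', Matrix.cons_val_zero, Matrix.cons_val_one,
    Matrix.cons_val_fin_one, diagonal_one, diagonal_zero, Matrix.mul_one, Matrix.mul_zero, Matrix.zero_mul,
    transpose_rungeMatrix_mul_dualRungeMatrix k l hΔ, transpose_dualRungeMatrix_mul_rungeMatrix hΔ]

/-- **The integral symplectic matrix `(1 0; B(x) 1) ∈ Sp₄(ℤ)`** whose `toGD 1`-image (`= ᵗM`, tree convention of row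
A4-16) is the lift `(1 B(x); 0 1)`. [cite: Runge1999EndomorphismRingsAbelianSurfaces, §4 p. 291] -/
def translSpInt (k l : ℤ) (x : QuadraticAlgebra ℤ k l) : Matrix (Fin 2 ⊕ Fin 2) (Fin 2 ⊕ Fin 2) ℤ :=
  Matrix.fromBlocks 1 0 (traceRegRep k l x) 1

/-- `ᵗM E₁ M = E₁` for `M = translSpInt x` (`B(x)` symmetric). [cite: Runge1999EndomorphismRingsAbelianSurfaces, §4 p. 291] -/
theorem translSpInt_symplectic (x : QuadraticAlgebra ℤ k l) :
    (translSpInt k l x)ᵀ * typeForm (fun _ : Fin 2 ↦ 1) * translSpInt k l x = typeForm (fun _ : Fin 2 ↦ 1) := by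
  have hB : (traceRegRep k l x)ᵀ = traceRegRep k l x := isSymm_traceRegRep x
  rw [typeForm_one_eq_neg_J, Matrix.J, translSpInt, Matrix.fromBlocks_transpose, Matrix.fromBlocks_neg,
    Matrix.fromBlocks_multiply, Matrix.fromBlocks_multiply, hB]
  simp

/-- `toGD 1 (translSpInt x)` is the lift of the translation by `x`. [cite: Runge1999EndomorphismRingsAbelianSurfaces, §4 p. 291] -/
theorem toGD_translSpInt (hΔ : 0 < quadDisc k l) (x : QuadraticAlgebra ℤ k l) :
    toGD (fun _ : Fin 2 ↦ 1) (translSpInt k l x) =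
      ((modularEmbeddingLift k l hΔ (translPair fun s ↦ realEmb hΔ.le s x) : Matrix.symplecticGroup (Fin 2) ℝ) :
        Matrix (Fin 2 ⊕ Fin 2) (Fin 2 ⊕ Fin 2) ℝ) := by
  have hB : ((traceRegRep k l x).map (Int.cast : ℤ → ℝ))ᵀ = (traceRegRep k l x).map (Int.cast : ℤ → ℝ) := by
    rw [← transpose_map, isSymm_traceRegRep x]
  rw [coe_modularEmbeddingLift_translPair, toGD_one_eq_transpose, translSpInt, Matrix.fromBlocks_map,
    Matrix.fromBlocks_transpose, hB, Matrix.map_one _ Int.cast_zero Int.cast_one, transpose_one,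
    Matrix.map_zero _ Int.cast_zero, transpose_zero]

/-- **The lift of the translation by `x ∈ O` is in `Sp₄(ℤ)`** (as the element `toGD 1 (translSpInt x)` of the tree's
`G_1 = gDHom(Sp₄(ℤ))`). [cite: Runge1999EndomorphismRingsAbelianSurfaces, §4 p. 291 (`x ∈ O ⟺ A(x) ∈ M₂(ℤ)`; Lemma 4)] -/
theorem modularEmbeddingLift_translPair_eq (hΔ : 0 < quadDisc k l) (x : QuadraticAlgebra ℤ k l) :
    modularEmbeddingLift k l hΔ (translPair fun s ↦ realEmb hΔ.le s x) =
      ⟨toGD (fun _ : Fin 2 ↦ 1) (translSpInt k l x), toGD_mem principalType_pos (translSpInt_symplectic x)⟩ :=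
  Subtype.ext (toGD_translSpInt hΔ x).symm

/-- **Translating `τ` by `(σ₁(x), σ₂(x))`, `x ∈ O`, moves `π[R](τ)` by an element of `Sp₄(ℤ)`.**
[cite: Runge1999EndomorphismRingsAbelianSurfaces, §4 pp. 290–291] -/
theorem modularEmbedding_transl (hΔ : 0 < quadDisc k l) (x : QuadraticAlgebra ℤ k l) (τ : Fin 2 → ℍ) :
    modularEmbedding k l hΔ (fun s ↦ translPair (fun s ↦ realEmb hΔ.le s x) s • τ s) =
      (⟨toGD (fun _ : Fin 2 ↦ 1) (translSpInt k l x), toGD_mem principalType_pos (translSpInt_symplectic x)⟩ :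
        Matrix.symplecticGroup (Fin 2) ℝ) • modularEmbedding k l hΔ τ := by
  rw [modularEmbedding_smul, modularEmbeddingLift_translPair_eq]

/-- The diagonal pair `diag(σ_s(ε), σ_s(ε'))` of a unit `ε` of `O` with inverse `ε'` (`τ_s ↦ σ_s(ε)² τ_s`).
[cite: Runge1999EndomorphismRingsAbelianSurfaces, §4 p. 291] -/
noncomputable def unitPair (hΔ : 0 < quadDisc k l) (ε ε' : QuadraticAlgebra ℤ k l) (h : ε * ε' = 1) :
    Fin 2 → Matrix.SpecialLinearGroup (Fin 2) ℝ :=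
  fun s ↦ ⟨!![realEmb hΔ.le s ε, 0; 0, realEmb hΔ.le s ε'], by
    rw [Matrix.det_fin_two_of, ← map_mul, h, map_one]; ring⟩

/-- Entries of `unitPair`. [cite: Runge1999EndomorphismRingsAbelianSurfaces, §4 p. 291] -/
@[simp] theorem coe_unitPair (hΔ : 0 < quadDisc k l) (ε ε' : QuadraticAlgebra ℤ k l) (h : ε * ε' = 1) (s : Fin 2) :
    ((unitPair hΔ ε ε' h s : Matrix.SpecialLinearGroup (Fin 2) ℝ) : Matrix (Fin 2) (Fin 2) ℝ) =
      !![realEmb hΔ.le s ε, 0; 0, realEmb hΔ.le s ε'] := rfl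

/-- `diag(0, 0) = 0`. [folklore] -/
private theorem diagonal_const_zero : diagonal (fun _ : Fin 2 ↦ (0 : ℝ)) = 0 := diagonal_zero

/-- `ᵗA(ε') ᵗA(ε) = 1`. [folklore] -/
private theorem transpose_regRep_mul (ε ε' : QuadraticAlgebra ℤ k l) (h : ε * ε' = 1) :
    (regRep k l ε')ᵀ * (regRep k l ε)ᵀ = 1 := by
  rw [← transpose_mul, ← regRep_mul, h, regRep_one, transpose_one]

/-- **`ᵗR diag(σ(x)) S = A(x)`** (Runge: "`A(x) = ᵗR σ(x) ᵗR⁻¹`"). [cite: Runge1999EndomorphismRingsAbelianSurfaces, §4 p. 290] -/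
theorem transpose_rungeMatrix_mul_diagonal_mul_dualRungeMatrix (hΔ : 0 < quadDisc k l) (x : QuadraticAlgebra ℤ k l) :
    (rungeMatrix k l)ᵀ * diagonal (fun s ↦ realEmb hΔ.le s x) * dualRungeMatrix k l =
      (regRep k l x).map (Int.cast : ℤ → ℝ) := by
  rw [← regRep_mul_transpose_rungeMatrix hΔ.le x, Matrix.mul_assoc, transpose_rungeMatrix_mul_dualRungeMatrix k l hΔ,
    Matrix.mul_one]

/-- `ᵗS diag(σ(x)) R = ᵗA(x)`. [cite: Runge1999EndomorphismRingsAbelianSurfaces, §4 p. 290] -/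
theorem transpose_dualRungeMatrix_mul_diagonal_mul_rungeMatrix (hΔ : 0 < quadDisc k l) (x : QuadraticAlgebra ℤ k l) :
    (dualRungeMatrix k l)ᵀ * diagonal (fun s ↦ realEmb hΔ.le s x) * rungeMatrix k l =
      ((regRep k l x).map (Int.cast : ℤ → ℝ))ᵀ := by
  rw [← transpose_rungeMatrix_mul_diagonal_mul_dualRungeMatrix hΔ x, transpose_mul, transpose_mul,
    transpose_transpose, diagonal_transpose, Matrix.mul_assoc]

/-- **The lift of the unit pair is `(A(ε) 0; 0 ᵗA(ε')) = blockDiagSp ᵗA(ε) ᵗA(ε')`** — the element of `Sp₄(ℤ)` by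
which the unit `ε` acts (row A4-64 `blockDiagSp`, row A4-67). [cite: Runge1999EndomorphismRingsAbelianSurfaces, §4 pp. 290–291] -/
theorem modularEmbeddingLift_unitPair (hΔ : 0 < quadDisc k l) (ε ε' : QuadraticAlgebra ℤ k l) (h : ε * ε' = 1) :
    modularEmbeddingLift k l hΔ (unitPair hΔ ε ε' h) =
      blockDiagSp (regRep k l ε)ᵀ (regRep k l ε')ᵀ (transpose_regRep_mul ε ε' h) := by
  apply Subtype.ext
  have h1 : (((regRep k l ε)ᵀ).map (Int.cast : ℤ → ℝ))ᵀ = (regRep k l ε).map (Int.cast : ℤ → ℝ) := by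
    rw [← transpose_map, transpose_transpose]
  have h2 : ((regRep k l ε')ᵀ).map (Int.cast : ℤ → ℝ) = ((regRep k l ε').map (Int.cast : ℤ → ℝ))ᵀ := by
    rw [← transpose_map]
  rw [coe_modularEmbeddingLift, coe_blockDiagSp, h1, h2, ← transpose_rungeMatrix_mul_diagonal_mul_dualRungeMatrix hΔ ε,
    ← transpose_dualRungeMatrix_mul_diagonal_mul_rungeMatrix hΔ ε']
  simp only [coe_unitPair, Matrix.of_apply, Matrix.cons_val', Matrix.cons_val_zero, Matrix.cons_val_one,
    Matrix.cons_val_fin_one, diagonal_const_zero, Matrix.mul_zero, Matrix.zero_mul]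

/-- **Multiplying `τ` factorwise by `σ_s(ε)²` (a unit `ε` of `O`) moves `π[R](τ)` by `blockDiagSp ᵗA(ε) ᵗA(ε⁻¹) ∈ Sp₄(ℤ)`.**
[cite: Runge1999EndomorphismRingsAbelianSurfaces, §4 pp. 290–291] -/
theorem modularEmbedding_unitPair_smul (hΔ : 0 < quadDisc k l) (ε ε' : QuadraticAlgebra ℤ k l) (h : ε * ε' = 1)
    (τ : Fin 2 → ℍ) :
    modularEmbedding k l hΔ (fun s ↦ unitPair hΔ ε ε' h s • τ s) =
      blockDiagSp (regRep k l ε)ᵀ (regRep k l ε')ᵀ (transpose_regRep_mul ε ε' h) • modularEmbedding k l hΔ τ := by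
  rw [modularEmbedding_smul, modularEmbeddingLift_unitPair]

end Integral

end Literature.AlgebraicGeometry.ModuliOfAbelianVarieties.SiegelModuli
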